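import Summits.BirchSwinnertonDyer.BirchSwinnertonDyer.Theorems.Rank2ObservatoryPadicAtlasKit
import Summits.BirchSwinnertonDyer.BirchSwinnertonDyer.Theorems.Rank2ObservatoryKrausMinimality
import Literature.NumberTheory.DiophantineGeometry.LocalReductionHasMultiplicativeReductionAtProofs
import HarnessLib

/-!
# Rank-2 observatory — `p`-adic atlas kit, minimality test with the full Kraus condition at `2`

HONEST FRAMING: per-curve certified theorems and census instruments; no claim on BSD in rank ≥ 2.

Extension of the atlas kit `Rank2ObservatoryPadicAtlasKit.lean` / `…KitMin2.lean` (append-only, so in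
a separate file) by a third kernel-evaluable global-minimality test `AtlasCurve.minCheck₃`, needed for
the last `4` curves of the two-engine rank-2 atlas whose Cremona models escape both `minCheck`
(`q¹² ∤ Δ ∨ q ∤ c₄`) and `minCheck₂` (`2⁸ ∤ c₄`): `9136c1` has `2¹⁰ ∣ c₄`, and `5715c1`, `6579e1`,
`8091c1` have `3¹³ ∣ Δ`, `3 ∣ c₄` (but `3⁴ ∤ c₄`).

* `kraus_two_c₆`: the `c₆`-part of **Kraus's necessary condition at `2`** — an integral Weierstrass
  equation over `ℤ₂` has `c₆ ≡ −1 (mod 4)` (`a₁` odd) or `c₆ ≡ 0 (mod 32)` (`a₁`, `a₃` even) or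
  `c₆ ≡ 8 (mod 32)` (`a₁` even, `a₃` odd) (Kraus 1989, Prop. 2: an integral model with given
  `c₄, c₆` exists iff `v₃(c₆) ≠ 2` and either `c₆ ≡ −1 (mod 4)` or `v₂(c₄) ≥ 4 ∧ c₆ ≡ 0, 8 (mod 32)`;
  only the displayed necessary half is proved and used here).
* `isMinimal_padic_two_of_kraus_c₆`: **`2⁸ ∤ c₆ + 64`, `2¹¹ ∤ c₆`, `2¹¹ ∤ c₆ − 512` ⟹ `W₀` is
  minimal at `2`.** If `C • W₀` were integral with `ord₂ u⁻¹ ≥ 1`, then `c₆' = u⁻⁶ c₆` integral and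
  `2¹¹ ∤ c₆` force `u⁻¹ = η/2`, `η ∈ ℤ₂ˣ`, `η⁶ ≡ 1 (mod 4)`, and the three cases of `kraus_two_c₆`
  for `C • W₀` give `2⁸ ∣ c₆ + 64`, `2¹¹ ∣ c₆`, `2¹¹ ∣ c₆ − 512` respectively.
* `isMinimalAt_baseChange_int_of_c₄_val_lt_four`: `q⁴ ∤ c₄ ⟹` minimal at `q` (AEC VII.1 Rem. 1.1,
  from the tree's `isMinimalAt_of_lt_valuation_c₄`), and the per-prime disjunction
  `isGloballyMinimal_baseChange_int_of_criteria`.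
* `AtlasCurve.minCheck₃` (finite Boolean test: `Δ ≠ 0`, `|Δ| < B¹²`, and for every `2 ≤ q < B`:
  `q¹² ∤ |Δ|`, or `q⁴ ∤ |c₄|`, or `q = 2` with `2⁸ ∤ |c₆ + 64|`, `2¹¹ ∤ |c₆|`, `2¹¹ ∤ |c₆ − 512|`),
  its soundness `AtlasCurve.isGloballyMinimal₃`, and the table accessor `AtlasCurve.check_of_all₃`.

No new definitions of mathematical objects (one Boolean test), no new axioms, no `sorry`.

References: A. Kraus, *Quelques remarques à propos des invariants c₄, c₆ et Δ d'une courbe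
elliptique*, Acta Arith. 54 (1989) 75–80, Prop. 2 (quoted as Prop. 1 of S. Wong, *On the density of
elliptic curves*, Compositio Math. 127 (2001), §2); J. H. Silverman, *The Arithmetic of Elliptic
Curves*, GTM 106 (2009), VII.1 Prop. 1.3, Remark 1.1, VIII.8; J. E. Cremona, *Algorithms for Modular
Elliptic Curves* (1997), §3.2.
-/

-- single-conjunct summit: `Summit.BirchSwinnertonDyer.BirchSwinnertonDyer.…` repeats the name by design
set_option linter.dupNamespace false

namespace Summit.BirchSwinnertonDyer.BirchSwinnertonDyer.Rank2Observatory

open IsDedekindDomain WeierstrassCurve Literature.NumberTheory.EllipticCurves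

/-! ### Kraus's necessary condition at `2`: the `c₆` congruences -/

/-- **Kraus's condition at `2`, necessary half, `c₆`-part.** An integral Weierstrass equation over
`ℤ₂` has `4 ∣ c₆ + 1` (when `a₁ = 2m + 1`: `b₂ ≡ 1 (mod 4)`), or `32 ∣ c₆` (when `a₁ = 2m`,
`a₃ = 2n`: `b₂ = 4s`, `b₄`, `b₆ ∈ 4ℤ₂ + 2ℤ₂…`), or `32 ∣ c₆ − 8` (when `a₁ = 2m`, `a₃ = 2n + 1`:
`−216 a₃² ≡ 8 (mod 32)`). [cite: Kraus1989, Prop. 2] -/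
theorem kraus_two_c₆ (Y : WeierstrassCurve ℤ_[2]) :
    (4 : ℤ_[2]) ∣ Y.c₆ + 1 ∨ (32 : ℤ_[2]) ∣ Y.c₆ ∨ (32 : ℤ_[2]) ∣ Y.c₆ - 8 := by
  obtain ⟨m, hm | hm⟩ := padicInt_two_exists_eq_two_mul_or Y.a₁
  · obtain ⟨n, hn | hn⟩ := padicInt_two_exists_eq_two_mul_or Y.a₃
    · refine Or.inr (Or.inl ⟨-2 * (m ^ 2 + Y.a₂) ^ 3 + 9 * (m ^ 2 + Y.a₂) * Y.a₄
        + 18 * (m ^ 2 + Y.a₂) * m * n - 27 * n ^ 2 - 27 * Y.a₆, ?_⟩)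
      simp only [WeierstrassCurve.c₆, WeierstrassCurve.b₂, WeierstrassCurve.b₄,
        WeierstrassCurve.b₆, hm, hn]
      ring
    · refine Or.inr (Or.inr ⟨-2 * (m ^ 2 + Y.a₂) ^ 3 + 9 * (m ^ 2 + Y.a₂) * Y.a₄
        + 18 * (m ^ 2 + Y.a₂) * m * n + 9 * (m ^ 2 + Y.a₂) * m - 27 * n ^ 2 - 27 * n - 7
        - 27 * Y.a₆, ?_⟩)
      simp only [WeierstrassCurve.c₆, WeierstrassCurve.b₂, WeierstrassCurve.b₄,
        WeierstrassCurve.b₆, hm, hn]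
      ring
  · refine Or.inl ⟨-16 * (m ^ 2 + m + Y.a₂) ^ 3 - 12 * (m ^ 2 + m + Y.a₂) ^ 2
      - 3 * (m ^ 2 + m + Y.a₂) + 9 * ((2 * m + 1) ^ 2 + 4 * Y.a₂) * Y.b₄ - 54 * Y.b₆, ?_⟩
    simp only [WeierstrassCurve.c₆, WeierstrassCurve.b₂, hm]
    ring

/-- `‖k‖₂ ≤ 2⁻¹¹` for an integer `k` means `2¹¹ ∣ k`. [folklore] -/
theorem two_pow_eleven_dvd_of_norm_le (k : ℤ) (hk : ‖(k : ℚ_[2])‖ ≤ 1 / 2048) :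
    (2 : ℤ) ^ 11 ∣ k := by
  have h := (Padic.norm_int_le_pow_iff_dvd (p := 2) k 11).mp (by
    have e : ((2 : ℕ) : ℝ) ^ (-(11 : ℕ) : ℤ) = 1 / 2048 := by norm_num
    rw [e]; exact hk)
  exact_mod_cast h

/-! ### The Tate–Kraus step with the `c₆` congruences: minimal at `2` -/

/-- **Minimality at `2` from Kraus's `c₆` condition.** For `W₀ / ℤ` with `2⁸ ∤ c₆ + 64`,
`2¹¹ ∤ c₆` and `2¹¹ ∤ c₆ − 512`, the equation `W₀ ⊗ ℚ₂` is a minimal Weierstrass equation over `ℤ₂`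
(Mathlib's `WeierstrassCurve.IsMinimal`): an integral `ℚ₂`-isomorphic equation `C • W₀` with
`ord₂ u⁻¹ ≥ 1` has integral `c₆' = u⁻⁶ c₆` (Silverman AEC VII.1.3), so `ord₂ u⁻¹ = -1` exactly
(else `2¹² ∣ c₆`), `u⁻¹ = η / 2` with `η⁶ ≡ 1 (mod 4)`, and the three cases of `kraus_two_c₆` for
`C • W₀` give `2⁸ ∣ c₆ + 64`, `2¹¹ ∣ c₆`, `2¹¹ ∣ c₆ − 512`. [cite: Kraus1989, Prop. 2] -/
theorem isMinimal_padic_two_of_kraus_c₆ (W₀ : WeierstrassCurve ℤ)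
    (h6 : ¬ (2 : ℤ) ^ 8 ∣ W₀.c₆ + 64) (h11 : ¬ (2 : ℤ) ^ 11 ∣ W₀.c₆)
    (h11' : ¬ (2 : ℤ) ^ 11 ∣ W₀.c₆ - 512) :
    ((W₀.baseChange ℚ).baseChange ℚ_[2]).IsMinimal ℤ_[2] := by
  set X := (W₀.baseChange ℚ).baseChange ℚ_[2] with hX
  have hV : ∀ x : ℚ_[2], NormedField.valuation x ≤ 1 ↔ x ∈ (algebraMap ℤ_[2] ℚ_[2]).range := by
    intro x
    rw [NormedField.valuation_apply, ← NNReal.coe_le_coe, coe_nnnorm, NNReal.coe_one]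
    constructor
    · intro hx
      exact ⟨⟨x, hx⟩, by rw [PadicInt.algebraMap_apply]⟩
    · rintro ⟨z, rfl⟩
      rw [PadicInt.algebraMap_apply, PadicInt.padic_norm_e_of_padicInt]
      exact PadicInt.norm_le_one z
  have hc₆X : X.c₆ = (W₀.c₆ : ℚ_[2]) := by
    simp [hX, WeierstrassCurve.baseChange, WeierstrassCurve.map_c₆]
  rw [isMinimal_iff_of_le_one_iff hV]
  refine ⟨⟨⟨W₀.map (Int.castRingHom ℤ_[2]), ?_⟩⟩, fun C hC => ?_⟩
  · have hφ : (algebraMap ℚ ℚ_[2]).comp (algebraMap ℤ ℚ) =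
        (algebraMap ℤ_[2] ℚ_[2]).comp (Int.castRingHom ℤ_[2]) := Subsingleton.elim _ _
    simp only [hX, WeierstrassCurve.baseChange, WeierstrassCurve.map_map, hφ]
  simp only [NormedField.valuation_apply, ← NNReal.coe_le_coe, coe_nnnorm, variableChange_Δ,
    norm_mul, norm_pow]
  set x : ℚ_[2] := ((C.u⁻¹ : ℚ_[2]ˣ) : ℚ_[2]) with hx
  by_cases hx1 : ‖x‖ ≤ 1
  · exact mul_le_of_le_one_left (norm_nonneg _) (pow_le_one₀ (norm_nonneg _) hx1)
  exfalso
  rw [not_le] at hx1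
  haveI := hC
  set Y := WeierstrassCurve.integralModel ℤ_[2] (C • X) with hY
  have hY6 : ((Y.c₆ : ℤ_[2]) : ℚ_[2]) = x ^ 6 * (W₀.c₆ : ℚ_[2]) := by
    rw [← PadicInt.algebraMap_apply, hY, WeierstrassCurve.integralModel_c₆_eq, variableChange_c₆,
      hc₆X]
  have hx0 : x ≠ 0 := by
    intro h
    rw [h, norm_zero] at hx1
    exact absurd hx1 (by norm_num)
  -- `‖x‖ = 2 ^ e` with `e ≥ 1`
  have two_le : (2 : ℝ) ≤ ‖x‖ := by
    rw [Padic.norm_eq_zpow_neg_valuation hx0] at hx1 ⊢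
    have he : 0 < -x.valuation := (one_lt_zpow_iff_right₀ (by norm_num : (1 : ℝ) < 2)).mp hx1
    calc (2 : ℝ) = 2 ^ (1 : ℤ) := by norm_num
      _ ≤ 2 ^ (-x.valuation) := zpow_le_zpow_right₀ (by norm_num) (by omega)
  -- `c₆' = x⁶ c₆` is integral
  have hY6n : ‖x‖ ^ 6 * ‖(W₀.c₆ : ℚ_[2])‖ ≤ 1 := by
    rw [← norm_pow, ← norm_mul, ← hY6, PadicInt.padic_norm_e_of_padicInt]
    exact PadicInt.norm_le_one _
  -- `‖x‖ = 2`: else `‖x‖ ≥ 4` and `2¹² ∣ c₆`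
  have hc6n : 1 / 2048 < ‖(W₀.c₆ : ℚ_[2])‖ := by
    rw [← not_le]
    exact fun h => h11 (two_pow_eleven_dvd_of_norm_le _ h)
  have x_le : ‖x‖ ≤ 2 := by
    have h6lt : ‖x‖ ^ 6 < 4 ^ 6 := by
      by_contra hge
      rw [not_lt] at hge
      have h4096 : (4096 : ℝ) * ‖(W₀.c₆ : ℚ_[2])‖ ≤ 1 :=
        le_trans (mul_le_mul_of_nonneg_right (by norm_num at hge ⊢; exact hge) (norm_nonneg _)) hY6n
      have : ‖(W₀.c₆ : ℚ_[2])‖ ≤ 1 / 2048 := by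
        rw [le_div_iff₀ (by norm_num : (0 : ℝ) < 2048)]; linarith
      linarith
    have hlt4 : ‖x‖ < 4 := lt_of_pow_lt_pow_left₀ 6 (by norm_num) h6lt
    rw [Padic.norm_eq_zpow_neg_valuation hx0] at hlt4 ⊢
    have hv : -x.valuation < 2 := by
      by_contra hge
      rw [not_lt] at hge
      have h' : (2 : ℝ) ^ (2 : ℤ) ≤ (2 : ℝ) ^ (-x.valuation) := zpow_le_zpow_right₀ (by norm_num) hge
      have h4' : (2 : ℝ) ^ (-x.valuation) < 4 := hlt4
      have e4 : (2 : ℝ) ^ (2 : ℤ) = 4 := by norm_num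
      linarith
    calc (2 : ℝ) ^ (-x.valuation) ≤ 2 ^ (1 : ℤ) := zpow_le_zpow_right₀ (by norm_num) (by omega)
      _ = 2 := by norm_num
  have x_eq : ‖x‖ = 2 := le_antisymm x_le two_le
  have hη1 : ‖(2 : ℚ_[2]) * x‖ = 1 := by rw [norm_mul, x_eq, padic_norm_two]; norm_num
  set η : ℤ_[2] := ⟨2 * x, hη1.le⟩ with hη
  have hηn : ‖η‖ = 1 := hη1
  obtain ⟨t, ht⟩ := four_dvd_pow_six_sub_one hηn
  have e2 : ((2 : ℚ_[2]) * x) ^ 6 - 1 = 4 * (t : ℚ_[2]) := by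
    have := congrArg ((↑) : ℤ_[2] → ℚ_[2]) ht
    push_cast [hη] at this
    exact this
  have e256 : ‖(256 : ℚ_[2])‖ = 1 / 256 := by
    rw [show (256 : ℚ_[2]) = 2 ^ 8 by norm_num, norm_pow, padic_norm_two]; norm_num
  have e2048 : ‖(2048 : ℚ_[2])‖ = 1 / 2048 := by
    rw [show (2048 : ℚ_[2]) = 2 ^ 11 by norm_num, norm_pow, padic_norm_two]; norm_num
  rcases kraus_two_c₆ Y with ⟨w, hw⟩ | ⟨w, hw⟩ | ⟨w, hw⟩
  · -- `4 ∣ c₆' + 1`: `η⁶ (c₆ + 64) = 64 (x⁶ c₆ + 1) + 64 (η⁶ − 1) = 256 (w + t)`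
    have e1 : x ^ 6 * (W₀.c₆ : ℚ_[2]) + 1 = 4 * (w : ℚ_[2]) := by
      rw [← hY6]; exact_mod_cast congrArg ((↑) : ℤ_[2] → ℚ_[2]) hw
    have key : ((2 : ℚ_[2]) * x) ^ 6 * ((W₀.c₆ : ℚ_[2]) + 64) = 256 * ((w : ℚ_[2]) + t) := by
      linear_combination (64 : ℚ_[2]) * e1 + (64 : ℚ_[2]) * e2
    apply h6
    apply two_pow_eight_dvd_of_norm_le
    have hn := congrArg norm key
    rw [norm_mul, norm_pow, hη1, one_pow, one_mul, norm_mul] at hn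
    have hwt : ‖(w : ℚ_[2]) + t‖ ≤ 1 := by
      rw [← PadicInt.coe_add, PadicInt.padic_norm_e_of_padicInt]; exact PadicInt.norm_le_one _
    push_cast
    rw [hn, e256]
    calc 1 / 256 * ‖(w : ℚ_[2]) + t‖ ≤ 1 / 256 * 1 := by gcongr
      _ = 1 / 256 := by ring
  · -- `32 ∣ c₆'`: `η⁶ c₆ = 64 x⁶ c₆ = 2048 w`
    have e1 : x ^ 6 * (W₀.c₆ : ℚ_[2]) = 32 * (w : ℚ_[2]) := by
      rw [← hY6]; exact_mod_cast congrArg ((↑) : ℤ_[2] → ℚ_[2]) hw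
    have key : ((2 : ℚ_[2]) * x) ^ 6 * (W₀.c₆ : ℚ_[2]) = 2048 * (w : ℚ_[2]) := by
      linear_combination (64 : ℚ_[2]) * e1
    apply h11
    apply two_pow_eleven_dvd_of_norm_le
    have hn := congrArg norm key
    rw [norm_mul, norm_pow, hη1, one_pow, one_mul, norm_mul] at hn
    have hwt : ‖(w : ℚ_[2])‖ ≤ 1 := by
      rw [PadicInt.padic_norm_e_of_padicInt]; exact PadicInt.norm_le_one _
    rw [hn, e2048]
    calc 1 / 2048 * ‖(w : ℚ_[2])‖ ≤ 1 / 2048 * 1 := by gcongr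
      _ = 1 / 2048 := by ring
  · -- `32 ∣ c₆' − 8`: `η⁶ (c₆ − 512) = 64 (x⁶ c₆ − 8) − 512 (η⁶ − 1) = 2048 (w − t)`
    have e1 : x ^ 6 * (W₀.c₆ : ℚ_[2]) - 8 = 32 * (w : ℚ_[2]) := by
      rw [← hY6]; exact_mod_cast congrArg ((↑) : ℤ_[2] → ℚ_[2]) hw
    have key : ((2 : ℚ_[2]) * x) ^ 6 * ((W₀.c₆ : ℚ_[2]) - 512) = 2048 * ((w : ℚ_[2]) - t) := by
      linear_combination (64 : ℚ_[2]) * e1 - (512 : ℚ_[2]) * e2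
    apply h11'
    apply two_pow_eleven_dvd_of_norm_le
    have hn := congrArg norm key
    rw [norm_mul, norm_pow, hη1, one_pow, one_mul, norm_mul] at hn
    have hwt : ‖(w : ℚ_[2]) - t‖ ≤ 1 := by
      rw [← PadicInt.coe_sub, PadicInt.padic_norm_e_of_padicInt]; exact PadicInt.norm_le_one _
    push_cast
    rw [hn, e2048]
    calc 1 / 2048 * ‖(w : ℚ_[2]) - t‖ ≤ 1 / 2048 * 1 := by gcongr
      _ = 1 / 2048 := by ring

/-- **Minimal at the place of `ℤ` over `2`** (the tree's `IsMinimalAt`, via the transport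
`isMinimalAt_iff_isMinimal_padic`). [cite: Kraus1989, Prop. 2] -/
theorem isMinimalAt_baseChange_int_two_of_kraus_c₆ (W₀ : WeierstrassCurve ℤ)
    (h6 : ¬ (2 : ℤ) ^ 8 ∣ W₀.c₆ + 64) (h11 : ¬ (2 : ℤ) ^ 11 ∣ W₀.c₆)
    (h11' : ¬ (2 : ℤ) ^ 11 ∣ W₀.c₆ - 512) {v : HeightOneSpectrum ℤ}
    (hv : Rat.HeightOneSpectrum.natGenerator v = 2) : (W₀.baseChange ℚ).IsMinimalAt v := by
  haveI : Fact (Nat.Prime 2) := ⟨Nat.prime_two⟩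
  exact (isMinimalAt_iff_isMinimal_padic v 2 hv _).mpr
    (isMinimal_padic_two_of_kraus_c₆ W₀ h6 h11 h11')

/-- **Minimality criterion `q⁴ ∤ c₄`** (Silverman AEC VII.1 Rem. 1.1: integral and `ord_q c₄ < 4`
⇒ minimal at `q`), for an integer model at a place of `ℤ` (the tree's
`isMinimalAt_of_lt_valuation_c₄`). [cite: SilvermanAEC2009, VII.1 Remark 1.1] -/
theorem isMinimalAt_baseChange_int_of_c₄_val_lt_four {v : HeightOneSpectrum ℤ}
    {W₀ : WeierstrassCurve ℤ} (h : ¬ (Rat.HeightOneSpectrum.natGenerator v : ℤ) ^ 4 ∣ W₀.c₄) :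
    (W₀.baseChange ℚ).IsMinimalAt v :=
  isMinimalAt_of_lt_valuation_c₄ (isIntegralAt_baseChange_int v W₀)
    (by rw [baseChange_int_c₄]
        exact (Literature.NumberTheory.EllipticCurves.Rat.exp_lt_valuation_intCast_iff v _ 4).mpr h)

/-- **Global minimality from per-prime criteria**: if every prime `q` has `q¹² ∤ Δ`, or `q⁴ ∤ c₄`,
or `q = 2` with Kraus's `c₆` condition `2⁸ ∤ c₆ + 64`, `2¹¹ ∤ c₆`, `2¹¹ ∤ c₆ − 512`, then `W₀ ⊗ ℚ` is
a global minimal equation (minimal at every place, AEC VIII.8).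
[cite: SilvermanAEC2009, VII.1 Remark 1.1] [cite: Kraus1989, Prop. 2] -/
theorem isGloballyMinimal_baseChange_int_of_criteria (W₀ : WeierstrassCurve ℤ)
    (h : ∀ q : ℕ, q.Prime → ¬ ((q : ℤ) ^ 12 ∣ W₀.Δ) ∨ ¬ ((q : ℤ) ^ 4 ∣ W₀.c₄) ∨
      (q = 2 ∧ ¬ (2 : ℤ) ^ 8 ∣ W₀.c₆ + 64 ∧ ¬ (2 : ℤ) ^ 11 ∣ W₀.c₆ ∧
        ¬ (2 : ℤ) ^ 11 ∣ W₀.c₆ - 512)) :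
    (W₀.baseChange ℚ).IsGloballyMinimal := by
  refine isGloballyMinimal_of_forall_isMinimalAt_int _ fun v => ?_
  rcases h _ (Rat.HeightOneSpectrum.prime_natGenerator v) with hΔ | h4 | ⟨hv, h6, h11, h11'⟩
  · exact isMinimalAt_baseChange_int_of_not_pow_dvd_Δ hΔ
  · exact isMinimalAt_baseChange_int_of_c₄_val_lt_four h4
  · exact isMinimalAt_baseChange_int_two_of_kraus_c₆ W₀ h6 h11 h11' hv

/-! ### The finite Boolean test -/

namespace AtlasCurve

variable (C : AtlasCurve)

/-- **The finite global-minimality criterion, third form**: `Δ ≠ 0`, `|Δ| < B¹²` (so `q¹² ∤ Δ` for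
`q ≥ B`), and for every `2 ≤ q < B`: `q¹² ∤ |Δ|`, or `q⁴ ∤ |c₄|`, or `q = 2` with `2⁸ ∤ |c₆ + 64|`,
`2¹¹ ∤ |c₆|`, `2¹¹ ∤ |c₆ − 512|` (Kraus at `2`).
[cite: Kraus1989, Prop. 2] [cite: SilvermanAEC2009, VII.1 Remark 1.1] -/
def minCheck₃ : Bool :=
  decide (C.e.Δ ≠ 0) && decide (C.e.Δ.natAbs < C.B ^ 12) &&
    (List.range C.B).all fun q =>
      decide (q < 2) || !decide (q ^ 12 ∣ C.e.Δ.natAbs) || !decide (q ^ 4 ∣ C.e.c₄.natAbs) ||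
        (decide (q = 2) && !decide (2 ^ 8 ∣ (C.e.c₆ + 64).natAbs) &&
          !decide (2 ^ 11 ∣ C.e.c₆.natAbs) && !decide (2 ^ 11 ∣ (C.e.c₆ - 512).natAbs))

variable {C}

/-- A curve passing the third finite criterion has a globally minimal integer model.
[cite: Kraus1989, Prop. 2] [cite: SilvermanAEC2009, VII.1 Remark 1.1] -/
theorem isGloballyMinimal₃ (h : C.minCheck₃ = true) : (C.e.baseChange ℚ).IsGloballyMinimal := by
  simp only [minCheck₃, Bool.and_eq_true, decide_eq_true_eq, List.all_eq_true, List.mem_range,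
    Bool.or_eq_true, Bool.not_eq_true', decide_eq_false_iff_not] at h
  obtain ⟨⟨hΔ, hB⟩, hq⟩ := h
  refine isGloballyMinimal_baseChange_int_of_criteria _ fun q hprime => ?_
  have e12 : ((q : ℤ) ^ 12 ∣ C.e.Δ) ↔ q ^ 12 ∣ C.e.Δ.natAbs := by
    rw [← Int.natCast_dvd, Nat.cast_pow]
  have e4 : ((q : ℤ) ^ 4 ∣ C.e.c₄) ↔ q ^ 4 ∣ C.e.c₄.natAbs := by
    rw [← Int.natCast_dvd, Nat.cast_pow]
  by_cases hqB : q < C.B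
  · rcases hq q hqB with ((hlt | h12) | h4) | ⟨⟨⟨h2, h6⟩, h11⟩, h11'⟩
    · exfalso
      have h2 := hprime.two_le
      omega
    · exact Or.inl fun h => h12 (e12.mp h)
    · exact Or.inr (Or.inl fun h => h4 (e4.mp h))
    · refine Or.inr (Or.inr ⟨h2, fun h => h6 ?_, fun h => h11 ?_, fun h => h11' ?_⟩)
      · exact Int.natCast_dvd.mp (by exact_mod_cast h)
      · exact Int.natCast_dvd.mp (by exact_mod_cast h)
      · exact Int.natCast_dvd.mp (by exact_mod_cast h)
  · left
    intro h
    have hpos : 0 < C.e.Δ.natAbs := Int.natAbs_pos.mpr hΔ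
    have hle : q ^ 12 ≤ C.e.Δ.natAbs := Nat.le_of_dvd hpos (e12.mp h)
    have hBq : C.B ^ 12 ≤ q ^ 12 := Nat.pow_le_pow_left (not_lt.mp hqB) 12
    omega

/-- From a table theorem `atlas.all (check ∧ minCheck₃) = true` to the two tests of a member.
[folklore] -/
theorem check_of_all₃ {atlas : List AtlasCurve}
    (h : atlas.all (fun C => C.check && C.minCheck₃) = true) {C : AtlasCurve} (hC : C ∈ atlas) :
    C.check = true ∧ C.minCheck₃ = true := by
  simp only [List.all_eq_true, Bool.and_eq_true] at h
  exact h C hC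

end AtlasCurve

end Summit.BirchSwinnertonDyer.BirchSwinnertonDyer.Rank2Observatory
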